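import Summits.Ventures.YMGap.RobustBall.RobustAreaLawBall
import Summits.Ventures.YMGap.Thresholds.OneLinkHolleyStroock
import HarnessLib

/-!
# Robust ball (Y2), area-law side — the robust slab door fed by a Poincaré × variance PAIR in Holley–Stroock form
# (headline row 3c's door: NO self-Lipschitz load, cross leg `√(e^{ε₀} c)` instead of `√N`)

HONEST FRAMING: venture file of the cell `pub-ymgap` (QuantumFields programme), track ROBUST-BALL, seat engine-2 (g6).  The SAME
robust slab door as rb-p2's `RobustSlabDoor` / `RobustSlabDoorVertex` / `RobustAreaLawBall` (perturbed slab specification `slabSpecW`,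
Dobrushin's condition in Kantorovich–Rubinstein form, covariance decay along profiles, the robust Durhuus–Fröhlich criterion
`areaLawOnBall_of_slabCovariance`), with ONE change of engine in the one-link step: instead of ds-4's robust transfer of an arbitrary
one-link modulus (`su_oneLink_robust_influence`: `C(x,y) = K e^δ(1 + 2√N ℓ(x))|β| m(x,y) + √N Λ(x,y)`) the engine-2 lineage-(iii)
Holley–Stroock lemma `OneLinkHolleyStroock.abs_integral_pert_sub_pert_le_of_pair` on a Poincaré × variance PAIR
`OneLinkPoincareSUN N R c`, `OneLinkVarianceBound N R v`:

  `C(x,y) = e^δ √(c v) |β| m(x,y) + √(e^δ c) Λ(x,y)`,   row sum `≤ e^δ √(c v)·2n|β| + √(e^δ c)·Λ₀(x)`.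

The density bound `dν^U/dν ≤ e^{osc U}` costs ONE factor `e^δ` on each variance and needs NO Lipschitz control of the re-weighting:
the self-Lipschitz load `ℓ` of the ball does not enter at all, and the cross leg carries `√(e^δ c)` (Pinsker-free Cauchy–Schwarz
against the perturbed Poincaré constant) in place of the diameter constant `√N`.  Output: `areaLawOnBall_of_pair` — for `N ≥ 2`,
tree coupling `β`, a pair on the slab ball `R ≥ 2n|β/N|` and the ROW CONDITION `e^{ε₀}·2n|β/N|√(c v) + √(e^{ε₀} c)·ε₁ < 1`,
`AreaLawOnBall N (n+1) β ε₀ ε₁ r mv` for every range `r` and vertical diameter `mv ≥ 1`.  This is the door of row 3c of the track's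
HEADLINE-CANDIDATES («variance slab door; not on anyone's queue»); rows (SU(2) hypothesis-free pairs, SU(3) certified pairs) are in
`AreaLawRowsPair`.  Strong-coupling finite-lattice statements; nothing about the continuum, a mass gap, or Clay.
-/

noncomputable section

open MeasureTheory ProbabilityTheory
open scoped Matrix
open Literature.Probability.LatticeModels hiding glue
open Literature.Probability.LatticeModels.DobrushinMetric
open Literature.MathematicalPhysics.QuantumLattice (fundamentalRep continuous_fundamentalRep fundamentalRep_apply)
open Literature.MathematicalPhysics.QuantumFieldTheory
open Literature.MathematicalPhysics.QuantumFieldTheory.DurhuusFrohlich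
open Summit.QuantumFields.BalabanUV.InfraRed.StrongCouplingPoincareDoorSUN (OneLinkPoincareSUN)
open Summit.QuantumFields.BalabanUV.InfraRed.StrongCouplingVarianceDoorSUN (OneLinkVarianceBound)
open Summit.Ventures.YMGap.OneLinkHolleyStroock (pert_eq_tilted_tilted abs_integral_pert_sub_pert_le_of_pair)

namespace Summit.Ventures.YMGap.RobustBall

variable {n L N : ℕ} [NeZero L] {W : GaugeConfig (n + 1) L (SU N) → ℝ}

/-! ### 1. The Holley–Stroock pair lemma in the door's double-tilt shape -/

omit [NeZero L] in
/-- `OneLinkHolleyStroock.abs_integral_pert_sub_pert_le_of_pair` for the re-weighted one-link laws written as `(ν_B)^{U}`: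
for `‖B‖_op, ‖B'‖_op ≤ R`, bounded measurable `U, U'` of oscillation `≤ δ` with `|U − U'| ≤ s` and bounded measurable `L`-Lipschitz `φ`,
`|∫ φ d(ν_B)^U − ∫ φ d(ν_{B'})^{U'}| ≤ e^δ √(c v)·L·‖B − B'‖_F + √(e^δ c)·L·s`. [cite: Follmer1988, Ch. I Theorem (2.13)] -/
theorem abs_integral_tilt_tilt_sub_le_of_pair {R c v δ : ℝ} (hc : 0 ≤ c) (hv0 : 0 ≤ v) (hP : OneLinkPoincareSUN N R c)
    (hV : OneLinkVarianceBound N R v)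
    {B B' : Matrix (Fin N) (Fin N) ℂ} (hB : matrixOpNorm B ≤ R) (hB' : matrixOpNorm B' ≤ R)
    {U U' : SU N → ℝ} (hUm : Measurable U) (hUb : ∃ C, ∀ g, |U g| ≤ C)
    (hosc : ∀ g h, U g ≤ U h + δ) (hU'm : Measurable U') (hU'b : ∃ C, ∀ g, |U' g| ≤ C)
    (hosc' : ∀ g h, U' g ≤ U' h + δ) {s : ℝ} (hs : ∀ g, |U g - U' g| ≤ s)
    (φ : SU N → ℝ) (Lφ : ℝ) (hφm : Measurable φ) (hφb : ∃ M, ∀ x, |φ x| ≤ M)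
    (hL : 0 ≤ Lφ) (hφL : ∀ a b, |φ a - φ b| ≤ Lφ * suFrobDist a b) :
    |∫ x, φ x ∂(((haarProbability (SU N)).tilted fun g : SU N => (N : ℝ) * ((g : Matrix (Fin N) (Fin N) ℂ) * B).trace.re).tilted U) -
        ∫ x, φ x ∂(((haarProbability (SU N)).tilted fun g : SU N => (N : ℝ) * ((g : Matrix (Fin N) (Fin N) ℂ) * B').trace.re).tilted U')| ≤
      Real.exp δ * Real.sqrt (c * v) * Lφ * frobNorm (B - B') + Real.sqrt (Real.exp δ * c) * Lφ * s := by
  rw [← pert_eq_tilted_tilted, ← pert_eq_tilted_tilted]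
  exact abs_integral_pert_sub_pert_le_of_pair hc hv0 hP hV hB hB' hUm hUb hosc hU'm hU'b hosc' hs φ Lφ hφm hφb hL hφL

/-! ### 2. Dobrushin's condition for the perturbed slab specification, Holley–Stroock coefficients -/

section Door

/-- **Dobrushin's condition for the perturbed slab specification from a one-link PAIR (Holley–Stroock form).**  Inputs: a
Poincaré × variance pair `OneLinkPoincareSUN N R c`, `OneLinkVarianceBound N R v` on the ball `R ≥ 2n|β|`; extra neighbourhoods
`nbrW x ∌ x` on which the site re-weightings read the boundary condition (up to `g`-independent constants); per-site loads of the
re-weighting: oscillation `h_{x,ω}(g) − h_{x,ω}(g') ≤ δ` and cross-Lipschitz `|h_{x,ω}(g) − h_{x,η}(g) − const| ≤ Λ(x,y)‖ω_y − η_y‖_F`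
for `ω = η` off `y` — NO self-Lipschitz load.  Output: `IsKRContraction` with `C(x,y) = e^δ√(cv)|β| m(x,y) + √(e^δ c) Λ(x,y)`.
[cite: Follmer1988, Ch. I (2.20)] -/
theorem isKRContraction_slabSpecW_pair (hN : 1 ≤ N) (hL1 : L ≠ 1) (v : Fin (n + 1)) (t : ZMod L)
    {β R c vv δ : ℝ} (hc : 0 ≤ c) (hvv : 0 ≤ vv) (hR : |β| * (2 * (n : ℝ)) ≤ R)
    (hP : OneLinkPoincareSUN N R c) (hV : OneLinkVarianceBound N R vv)
    (hWm : Measurable W) (hWb : ∃ C, ∀ U, |W U| ≤ C) (r : {e : Edge (n + 1) L // ¬ IsSlab v t e} → SU N)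
    (nbrW : TorusSite n L → Finset (TorusSite n L)) (hnotW : ∀ x, x ∉ nbrW x)
    (hdep : ∀ x (η η' : TorusSite n L → SU N), (∀ z ∈ Slab.slabNbr x ∪ nbrW x, η z = η' z) →
      ∃ c : ℝ, ∀ g, siteTiltW v t W r x η g = c + siteTiltW v t W r x η' g)
    (hδ : ∀ x ω g g', siteTiltW v t W r x ω g - siteTiltW v t W r x ω g' ≤ δ)
    (Λ : TorusSite n L → TorusSite n L → ℝ) (hΛ0 : ∀ x y, 0 ≤ Λ x y)
    (hΛ : ∀ x y (ω η : TorusSite n L → SU N), (∀ z, z ≠ y → ω z = η z) → ∃ c : ℝ, ∀ g,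
      |siteTiltW v t W r x ω g - (c + siteTiltW v t W r x η g)| ≤ Λ x y * suFrobDist (ω y) (η y)) :
    IsKRContraction (slabSpecW v t β W r) suFrobDist (fun x => Slab.slabNbr x ∪ nbrW x)
      (fun x y => Real.exp δ * Real.sqrt (c * vv) * |β| * (Slab.slabInfluence x y : ℝ) + Real.sqrt (Real.exp δ * c) * Λ x y) := by
  classical
  have hL : ∀ e : Slab.SlabEdge n L, e.tgt ≠ e.1 := Slab.SlabEdge.tgt_ne_fst hL1
  have hnot : ∀ x, x ∉ Slab.slabNbr x ∪ nbrW x := fun x =>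
    Finset.notMem_union.2 ⟨Slab.not_mem_slabNbr hL x, hnotW x⟩
  refine ⟨hnot, fun x y => by have := hΛ0 x y; positivity, fun x η η' h => ?_, ?_⟩
  · -- finite range: the site law reads `ω` on `nbr x` only (Wilson part through `slabNbr x ⊆ nbr x`, `W` part up to a constant)
    obtain ⟨a, ha⟩ := hdep x η η' h
    have hF : Slab.slabField β (topOf v t r) (botOf v t r) η x = Slab.slabField β (topOf v t r) (botOf v t r) η' x := by
      unfold Slab.slabField
      rw [Slab.slabStapleSum_congr _ _ x (fun z hz => h z (Finset.mem_union_left _ hz))]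
    have hh : (fun g => -siteTiltW v t W r x η g) = fun g => -a + -siteTiltW v t W r x η' g := by
      funext g; rw [ha g]; ring
    haveI := OneLinkTiltStability.su_isProbabilityMeasure_tilted_linear (N := N)
      (Slab.slabField β (topOf v t r) (botOf v t r) η' x)
    rw [siteLaw_slabSpecW_thooft v t β hWm r x η hL, siteLaw_slabSpecW_thooft v t β hWm r x η' hL, hF, hh]
    exact tilted_const_add_eq _ _ _
  · intro x y _ ω η hωη φ Lφ hφm hφb hL0 hφL
    obtain ⟨c₁, hc₁⟩ := hΛ x y ω η hωη
    rw [siteLaw_slabSpecW_thooft v t β hWm r x ω hL, siteLaw_slabSpecW_thooft v t β hWm r x η hL]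
    have hBω : matrixOpNorm (Slab.slabField β (topOf v t r) (botOf v t r) ω x) ≤ R :=
      (Slab.matrixOpNorm_slabField_le hN β _ _ ω x).trans hR
    have hBη : matrixOpNorm (Slab.slabField β (topOf v t r) (botOf v t r) η x) ≤ R :=
      (Slab.matrixOpNorm_slabField_le hN β _ _ η x).trans hR
    -- shifting the second re-weighting by the constant `c` does not change its one-site law
    haveI := OneLinkTiltStability.su_isProbabilityMeasure_tilted_linear (N := N)
      (Slab.slabField β (topOf v t r) (botOf v t r) η x)
    have hshift : ((haarProbability (SU N)).tilted fun g : SU N =>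
          (N : ℝ) * ((g : Matrix (Fin N) (Fin N) ℂ) * Slab.slabField β (topOf v t r) (botOf v t r) η x).trace.re).tilted
          (fun g => -siteTiltW v t W r x η g) =
        ((haarProbability (SU N)).tilted fun g : SU N =>
          (N : ℝ) * ((g : Matrix (Fin N) (Fin N) ℂ) * Slab.slabField β (topOf v t r) (botOf v t r) η x).trace.re).tilted
          (fun g => -(c₁ + siteTiltW v t W r x η g)) := by
      have : (fun g : SU N => -(c₁ + siteTiltW v t W r x η g)) = fun g => -c₁ + -siteTiltW v t W r x η g := by
        funext g; ring
      rw [this, tilted_const_add_eq]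
    rw [hshift]
    obtain ⟨Mω, hMω⟩ := exists_abs_siteTiltW_le v t hWb r x ω
    obtain ⟨Mη, hMη⟩ := exists_abs_siteTiltW_le v t hWb r x η
    have key := abs_integral_tilt_tilt_sub_le_of_pair (N := N) (δ := δ) hc hvv hP hV hBω hBη
      (U := fun g => -siteTiltW v t W r x ω g) (U' := fun g => -(c₁ + siteTiltW v t W r x η g))
      (measurable_siteTiltW v t hWm r x ω).neg ⟨Mω, fun g => by rw [abs_neg]; exact hMω g⟩
      (fun g h => by linarith [hδ x ω h g])
      ((measurable_siteTiltW v t hWm r x η).const_add c₁).neg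
      ⟨|c₁| + Mη, fun g => by rw [abs_neg]; exact (abs_add_le _ _).trans (by linarith [hMη g])⟩
      (fun g h => by linarith [hδ x η h g])
      (s := Λ x y * suFrobDist (ω y) (η y))
      (fun g => by
        have := hc₁ g
        rwa [show -siteTiltW v t W r x ω g - -(c₁ + siteTiltW v t W r x η g) =
          -(siteTiltW v t W r x ω g - (c₁ + siteTiltW v t W r x η g)) by ring, abs_neg])
      φ Lφ hφm hφb hL0 hφL
    refine key.trans ?_
    have hdiff := Slab.frobNorm_slabField_sub_le β (topOf v t r) (botOf v t r) x y hωη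
    have hfac : 0 ≤ Real.exp δ * Real.sqrt (c * vv) * Lφ := by positivity
    calc Real.exp δ * Real.sqrt (c * vv) * Lφ *
            frobNorm (Slab.slabField β (topOf v t r) (botOf v t r) ω x - Slab.slabField β (topOf v t r) (botOf v t r) η x) +
            Real.sqrt (Real.exp δ * c) * Lφ * (Λ x y * suFrobDist (ω y) (η y))
        ≤ Real.exp δ * Real.sqrt (c * vv) * Lφ * (|β| * Slab.slabInfluence x y * suFrobDist (ω y) (η y)) +
            Real.sqrt (Real.exp δ * c) * Lφ * (Λ x y * suFrobDist (ω y) (η y)) :=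
          add_le_add (mul_le_mul_of_nonneg_left hdiff hfac) le_rfl
      _ = (Real.exp δ * Real.sqrt (c * vv) * |β| * (Slab.slabInfluence x y : ℝ) + Real.sqrt (Real.exp δ * c) * Λ x y) * Lφ *
            suFrobDist (ω y) (η y) := by ring

/-- Row sums of the Holley–Stroock coefficients: `∑_{y ∈ nbr x} C(x,y) ≤ e^δ√(cv)·2n|β| + √(e^δ c)·Λ₀(x)` when the cross-Lipschitz
row load at `x` is `≤ Λ₀(x)`. [folklore] -/
theorem slabW_rowsum_le_pair (x : TorusSite n L) {β c vv δ : ℝ} (Λ₀ : TorusSite n L → ℝ)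
    (nbrW : TorusSite n L → Finset (TorusSite n L))
    (Λ : TorusSite n L → TorusSite n L → ℝ) (hrow : ∑ y ∈ Slab.slabNbr x ∪ nbrW x, Λ x y ≤ Λ₀ x) :
    ∑ y ∈ Slab.slabNbr x ∪ nbrW x,
        (Real.exp δ * Real.sqrt (c * vv) * |β| * (Slab.slabInfluence x y : ℝ) + Real.sqrt (Real.exp δ * c) * Λ x y) ≤
      Real.exp δ * Real.sqrt (c * vv) * (2 * (n : ℝ) * |β|) + Real.sqrt (Real.exp δ * c) * Λ₀ x := by
  classical
  have hnbr : Slab.slabNbr x ⊆ Slab.slabNbr x ∪ nbrW x := Finset.subset_union_left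
  rw [Finset.sum_add_distrib, ← Finset.mul_sum, ← Finset.mul_sum]
  have hinfl : ∑ y ∈ Slab.slabNbr x ∪ nbrW x, (Slab.slabInfluence x y : ℝ) =
      ∑ y ∈ Slab.slabNbr x, (Slab.slabInfluence x y : ℝ) := by
    rw [← Finset.sum_subset hnbr fun y _ hy => by rw [slabInfluence_eq_zero_of_not_mem hy, Nat.cast_zero]]
  have h2n : ∑ y ∈ Slab.slabNbr x, (Slab.slabInfluence x y : ℝ) ≤ 2 * (n : ℝ) := by
    exact_mod_cast Slab.sum_slabInfluence_le x
  rw [hinfl]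
  refine add_le_add ?_ (mul_le_mul_of_nonneg_left (hrow) (Real.sqrt_nonneg _))
  calc Real.exp δ * Real.sqrt (c * vv) * |β| * ∑ y ∈ Slab.slabNbr x, (Slab.slabInfluence x y : ℝ)
      ≤ Real.exp δ * Real.sqrt (c * vv) * |β| * (2 * (n : ℝ)) := mul_le_mul_of_nonneg_left h2n (by positivity)
    _ = Real.exp δ * Real.sqrt (c * vv) * (2 * (n : ℝ) * |β|) := by ring

/-- **Robust slab door from a pair, covariance form** (as rb-p2's `slab_covariance_le_W_site`, Holley–Stroock coefficients, row-sum
parameter `cc` with `e^δ√(cv)·2n|β| + √(e^δ c)·Λ₀(x) ≤ cc ≤ 1` at every site): for EVERY rest `r` and all bounded measurable single-site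
observables `f, g` at `x, y` with Frobenius-Lipschitz constants `δf, δg`, every profile vanishing at `y` and 1-Lipschitz along `nbr`:
`|Cov_{slabLawW}(f, g)| ≤ 2(2√N)² δg δf cc^{prof x}`. [cite: CaoNissimSheffield2025dynamical, Def. 2.1 and Thm. 2.3] [cite: Follmer1988, Ch. I Theorem (2.13)] -/
theorem slab_covariance_le_W_pair (hN : 1 ≤ N) (hL1 : L ≠ 1) (v : Fin (n + 1)) (t : ZMod L)
    {β R c vv δ cc : ℝ} (hc : 0 ≤ c) (hvv : 0 ≤ vv) (Λ₀ : TorusSite n L → ℝ) (hR : |β| * (2 * (n : ℝ)) ≤ R)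
    (hP : OneLinkPoincareSUN N R c) (hV : OneLinkVarianceBound N R vv)
    (hWm : Measurable W) (hWb : ∃ C, ∀ U, |W U| ≤ C) (r : {e : Edge (n + 1) L // ¬ IsSlab v t e} → SU N)
    (nbrW : TorusSite n L → Finset (TorusSite n L)) (hnotW : ∀ x, x ∉ nbrW x)
    (hdep : ∀ x (η η' : TorusSite n L → SU N), (∀ z ∈ Slab.slabNbr x ∪ nbrW x, η z = η' z) →
      ∃ c : ℝ, ∀ g, siteTiltW v t W r x η g = c + siteTiltW v t W r x η' g)
    (hδ : ∀ x ω g g', siteTiltW v t W r x ω g - siteTiltW v t W r x ω g' ≤ δ)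
    (Λ : TorusSite n L → TorusSite n L → ℝ) (hΛ0 : ∀ x y, 0 ≤ Λ x y)
    (hΛ : ∀ x y (ω η : TorusSite n L → SU N), (∀ z, z ≠ y → ω z = η z) → ∃ c : ℝ, ∀ g,
      |siteTiltW v t W r x ω g - (c + siteTiltW v t W r x η g)| ≤ Λ x y * suFrobDist (ω y) (η y))
    (hrow : ∀ x, ∑ y ∈ Slab.slabNbr x ∪ nbrW x, Λ x y ≤ Λ₀ x) (hcc0 : 0 ≤ cc) (hcc1 : cc ≤ 1)
    (hrowc : ∀ x, Real.exp δ * Real.sqrt (c * vv) * (2 * (n : ℝ) * |β|) + Real.sqrt (Real.exp δ * c) * Λ₀ x ≤ cc)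
    (x y : TorusSite n L)
    {f g : (TorusSite n L → SU N) → ℝ} (hfm : Measurable f) (hfdep : DependsOn f ({x} : Set (TorusSite n L)))
    {Mf : ℝ} (hMf : ∀ σ, |f σ| ≤ Mf) {δf : ℝ} (hδf : IsLipBound suFrobDist f fun z => if z = x then δf else 0)
    (hgm : Measurable g) (hgdep : DependsOn g ({y} : Set (TorusSite n L))) {Mg : ℝ} (hMg : ∀ σ, |g σ| ≤ Mg)
    {δg : ℝ} (hδg : IsLipBound suFrobDist g fun z => if z = y then δg else 0)
    (prof : TorusSite n L → ℕ) (hprof0 : prof y = 0)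
    (hprof : ∀ z, z ≠ y → ∀ w ∈ Slab.slabNbr z ∪ nbrW z, prof z ≤ prof w + 1) :
    |cov[f, g; slabLawW v t β W r]| ≤
      2 * (2 * Real.sqrt N) ^ 2 * δg * (cc ^ prof x * δf) := by
  classical
  have hγ := isSpecification_slabSpecW (n := n) (L := L) v t β hWm hWb r
  have hKR := isKRContraction_slabSpecW_pair hN hL1 v t hc hvv hR hP hV hWm hWb r nbrW hnotW hdep hδ Λ hΛ0 hΛ
  have key := abs_covariance_le_of_isKRContraction hγ hKR suFrobDist_nonneg suFrobDist_le (by positivity) hcc0 hcc1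
    (fun z => (slabW_rowsum_le_pair z Λ₀ nbrW Λ (hrow z)).trans (hrowc z))
    (isGibbsMeasure_slabLawW v t β hWm hWb r) hfm (Δf := {x})
    (by simpa using hfdep) hMf hδf hgm (Δg := {y}) (by simpa using hgdep) hMg hδg prof
    (fun z hz => by rw [Finset.mem_singleton.1 hz, hprof0]) (fun z hz w hw => hprof z (by simpa using hz) w hw)
  simpa using key

/-- **The pair-fed robust slab door in clustering shape** (as rb-p2's `slabLawW_entry_cov_le_site`): under the hypotheses of
`slab_covariance_le_W_pair` and neighbourhoods of graph-diameter `≤ r_W` (`r_W ≥ 1`), for all sites `x, y`, indices and `φ, ψ ∈ {Re, Im}`,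
`|Cov_{slabLawW}(φ(Q_x)_{ij}, ψ(Q_y⁻¹)_{kl})| ≤ (8N/c') e^{−((−log c')/r_W) d(x,y)}`, `c' = max(cc, 1/2)` — constants independent of the rest,
the boundary fields, the height and `L`. [cite: CaoNissimSheffield2025dynamical, Theorem 2.3] [cite: Follmer1988, Ch. I Theorem (2.13)] -/
theorem slabLawW_entry_cov_le_pair (hN : 1 ≤ N) (v : Fin (n + 1)) (t : ZMod L)
    {β R c vv δ cc : ℝ} (hc : 0 ≤ c) (hvv : 0 ≤ vv) (Λ₀ : TorusSite n L → ℝ) (hR : |β| * (2 * (n : ℝ)) ≤ R)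
    (hP : OneLinkPoincareSUN N R c) (hV : OneLinkVarianceBound N R vv)
    (hWm : Measurable W) (hWb : ∃ C, ∀ U, |W U| ≤ C) (r : {e : Edge (n + 1) L // ¬ IsSlab v t e} → SU N)
    (nbrW : TorusSite n L → Finset (TorusSite n L)) (hnotW : ∀ x, x ∉ nbrW x)
    (hdep : ∀ x (η η' : TorusSite n L → SU N), (∀ z ∈ Slab.slabNbr x ∪ nbrW x, η z = η' z) →
      ∃ c : ℝ, ∀ g, siteTiltW v t W r x η g = c + siteTiltW v t W r x η' g)
    (hδ : ∀ x ω g g', siteTiltW v t W r x ω g - siteTiltW v t W r x ω g' ≤ δ)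
    (Λ : TorusSite n L → TorusSite n L → ℝ) (hΛ0 : ∀ x y, 0 ≤ Λ x y)
    (hΛ : ∀ x y (ω η : TorusSite n L → SU N), (∀ z, z ≠ y → ω z = η z) → ∃ c : ℝ, ∀ g,
      |siteTiltW v t W r x ω g - (c + siteTiltW v t W r x η g)| ≤ Λ x y * suFrobDist (ω y) (η y))
    (hrow : ∀ x, ∑ y ∈ Slab.slabNbr x ∪ nbrW x, Λ x y ≤ Λ₀ x) (hcc0 : 0 ≤ cc) (hcc1 : cc ≤ 1)
    (hrowc : ∀ x, Real.exp δ * Real.sqrt (c * vv) * (2 * (n : ℝ) * |β|) + Real.sqrt (Real.exp δ * c) * Λ₀ x ≤ cc)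
    {rW : ℕ} (hrW : 1 ≤ rW) (hrange : ∀ z, ∀ w ∈ Slab.slabNbr z ∪ nbrW z, torusGraphDist z w ≤ rW)
    (x y : TorusSite n L) (i j k l : Fin N) (φ ψ : ℂ → ℝ)
    (hφ : φ = Complex.re ∨ φ = Complex.im) (hψ : ψ = Complex.re ∨ ψ = Complex.im) :
    |cov[fun Q => φ ((Q x : Matrix (Fin N) (Fin N) ℂ) i j),
        fun Q => ψ ((((Q y)⁻¹ : Matrix.specialUnitaryGroup (Fin N) ℂ) : Matrix (Fin N) (Fin N) ℂ) k l);
        slabLawW v t β W r]| ≤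
      8 * N * (max cc (1 / 2))⁻¹ * Real.exp (-(-Real.log (max cc (1 / 2)) / rW) * torusGraphDist x y) := by
  classical
  set c' : ℝ := max cc (1 / 2) with hc'
  have hc'0 : 0 < c' := lt_max_of_lt_right (by norm_num)
  have hc'1 : c' ≤ 1 := max_le hcc1 (by norm_num)
  haveI := isProbabilityMeasure_slabLawW (n := n) (L := L) (N := N) v t β hWm hWb r
  obtain ⟨hfm, hfdep, hf1, hfL⟩ := Slab.entryObs_props (n := n) (L := L) x i j hφ
  obtain ⟨hgm, hgdep, hg1, hgL⟩ := Slab.invEntryObs_props (n := n) (L := L) y k l hψ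
  have hN8 : (2 : ℝ) * (2 * Real.sqrt N) ^ 2 = 8 * N := by
    rw [mul_pow, Real.sq_sqrt (Nat.cast_nonneg N)]; ring
  have hNr : (1 : ℝ) ≤ N := by exact_mod_cast hN
  by_cases hL1 : L = 1
  · -- degenerate slice: one site, crude bound `|cov| ≤ 4 ≤ 8N/c'`
    subst hL1
    have hxy : x = y := Subsingleton.elim _ _
    subst hxy
    have h4 := Slab.abs_cov_le_of_abs_le (μ := slabLawW v t β W r) hf1 hg1
    rw [torusGraphDist_self, Nat.cast_zero, mul_zero, Real.exp_zero, mul_one]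
    have hinv : (1 : ℝ) ≤ c'⁻¹ := one_le_inv_iff₀.2 ⟨hc'0, hc'1⟩
    calc _ ≤ 2 * 1 * (2 * 1) := h4
      _ ≤ 8 * N * c'⁻¹ := by nlinarith
  · obtain ⟨hp0, hp⟩ := div_profile (n := n) (L := L) y hrW (fun z => Slab.slabNbr z ∪ nbrW z) hrange
    have key := slab_covariance_le_W_pair hN hL1 v t hc hvv Λ₀ hR hP hV hWm hWb r nbrW hnotW hdep hδ Λ hΛ0 hΛ hrow hcc0 hcc1
      hrowc x y hfm hfdep hf1 hfL hgm hgdep hg1 hgL (fun z => torusGraphDist z y / rW) hp0 hp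
    have hexp := pow_div_le_exp hcc0 hcc1 hrW (torusGraphDist x y)
    calc _ ≤ 2 * (2 * Real.sqrt N) ^ 2 * 1 * (cc ^ (torusGraphDist x y / rW) * 1) := key
      _ = 8 * N * cc ^ (torusGraphDist x y / rW) := by rw [← hN8]; ring
      _ ≤ 8 * N * (c'⁻¹ * Real.exp (-(-Real.log c' / rW) * torusGraphDist x y)) :=
          mul_le_mul_of_nonneg_left hexp (by positivity)
      _ = 8 * N * c'⁻¹ * Real.exp (-(-Real.log c' / rW) * torusGraphDist x y) := by ring

end Door

/-! ### 3. Reading the loads off the ball: the area law on the ball from a pair -/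

section Ball

/-- **Slab covariance on the ball from a pair** (as rb-p2's `slabCovariance_of_oneLinkKRModulus`, Holley–Stroock coefficients): with
`c_W = 2n|βt|√(cv)` and the ROW CONDITION `cc := e^{ε₀} c_W + √(e^{ε₀} c)·ε₁ ≤ 1`, the perturbed slab laws of every member of
`ClusterDomainFR ε₀ ε₁ r` cluster with constants `(8N/c', (−log c')/max(n r, 1))`, `c' = max(cc, 1/2)` — the member's oscillation load
feeds `δ = ε₀`, its CROSS-Lipschitz load feeds `Λ₀ ≤ ε₁`; its self-Lipschitz load is not used. [cite: CaoNissimSheffield2025dynamical, Theorem 2.3] -/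
theorem slabCovariance_of_pair (hN : 1 ≤ N) (βt : ℝ) {R c vv : ℝ} (hc : 0 ≤ c) (hvv : 0 ≤ vv)
    (hP : OneLinkPoincareSUN N R c) (hV : OneLinkVarianceBound N R vv)
    (hR : |βt| * (2 * (n : ℝ)) ≤ R) {ε₀ ε₁ : ℝ} (h₁ : 0 ≤ ε₁) (r mv : ℕ)
    (hcc : Real.exp ε₀ * Real.sqrt (c * vv) * (2 * (n : ℝ) * |βt|) + Real.sqrt (Real.exp ε₀ * c) * ε₁ ≤ 1)
    (L : ℕ) [NeZero L] (W : Perturbation (n + 1) L N) (hWball : W ∈ ClusterDomainFR ε₀ ε₁ r) (_hWloc : IsSlabLocal mv W)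
    (v : Fin (n + 1)) (t : ZMod L) (rest : {e : Edge (n + 1) L // ¬ IsSlab v t e} → SU N) (x y : Site n L)
    (i j k l : Fin N) (φ ψ : ℂ → ℝ) (hφ : φ = Complex.re ∨ φ = Complex.im) (hψ : ψ = Complex.re ∨ ψ = Complex.im) :
    |cov[fun Q => φ ((Q x : Matrix (Fin N) (Fin N) ℂ) i j),
        fun Q => ψ ((((Q y)⁻¹ : Matrix.specialUnitaryGroup (Fin N) ℂ) : Matrix (Fin N) (Fin N) ℂ) k l);
        slabLawW v t βt W.total rest]| ≤
      8 * N * (max (Real.exp ε₀ * Real.sqrt (c * vv) * (2 * (n : ℝ) * |βt|) + Real.sqrt (Real.exp ε₀ * c) * ε₁) (1 / 2))⁻¹ *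
        Real.exp (-(-Real.log (max (Real.exp ε₀ * Real.sqrt (c * vv) * (2 * (n : ℝ) * |βt|) + Real.sqrt (Real.exp ε₀ * c) * ε₁)
          (1 / 2)) / (max (n * r) 1 : ℕ)) * torusGraphDist x y) := by
  classical
  obtain ⟨hrange, w, hosc, hlip⟩ := hWball
  have hcl : ∀ e, w.crossLipLoad 0 e ≤ ε₁ := fun e =>
    le_trans (le_add_of_nonneg_left (Finset.sum_nonneg fun X _ =>
      mul_nonneg (Real.exp_pos _).le ((w.lip_spec X).nonneg e))) (hlip e)
  have hcc0 : 0 ≤ Real.exp ε₀ * Real.sqrt (c * vv) * (2 * (n : ℝ) * |βt|) + Real.sqrt (Real.exp ε₀ * c) * ε₁ := by positivity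
  exact slabLawW_entry_cov_le_pair (n := n) (L := L) (N := N) (W := W.total) hN v t (β := βt) (R := R)
    (δ := ε₀) (cc := Real.exp ε₀ * Real.sqrt (c * vv) * (2 * (n : ℝ) * |βt|) + Real.sqrt (Real.exp ε₀ * c) * ε₁)
    hc hvv (fun _ => ε₁) hR hP hV W.measurable_total W.exists_abs_total_le rest (nbrBall r)
    (not_mem_nbrBall r) (fun x' η η' h => siteTiltW_total_dep W rest hrange x' η η' h)
    (fun x' ω g g' => (siteTiltW_total_osc W rest w x' ω g g').trans (hosc _))
    (crossCoeff W w v t) (fun x' y' => crossCoeff_nonneg W w x' y')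
    (fun x' y' ω η h => siteTiltW_total_cross W rest w x' y' h)
    (fun x' => (crossCoeff_rowsum_le W w r x').trans (hcl _)) hcc0 hcc (fun _ => le_rfl) (le_max_right _ _)
    (fun z w' hw' => dist_le_of_mem_nbr r z w' hw') x y i j k l φ ψ hφ hψ

/-- **AREA LAW ON THE BALL FROM A ONE-LINK PAIR (Holley–Stroock door, explicit row condition).**  Let `N ≥ 2`, `β` the tree coupling
('t Hooft `β/N`), `OneLinkPoincareSUN N R c` and `OneLinkVarianceBound N R v` (`0 ≤ c, v`) a one-link pair on the slab ball `R ≥ 2n|β/N|`,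
`0 ≤ ε₁`, a range `r`, a vertical diameter `mv ≥ 1`, and suppose the ROW CONDITION `e^{ε₀}·(2n|β/N|√(c v)) + √(e^{ε₀} c)·ε₁ < 1`.  Then
`AreaLawOnBall N (n+1) β ε₀ ε₁ r mv`: Wilson's area law for the rectangular loops under EVERY member of `ClusterDomainFR ε₀ ε₁ r ∩ IsSlabLocal mv`,
constants uniform on the ball and in `L`.  No self-Lipschitz load enters; the cross load enters through `√(e^{ε₀} c)`, not `√N`.
[cite: CaoNissimSheffield2025dynamical, Theorem 2.3] -/
theorem areaLawOnBall_of_pair (hN : 2 ≤ N) (β : ℝ) {R c vv : ℝ} (hc : 0 ≤ c) (hvv : 0 ≤ vv)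
    (hP : OneLinkPoincareSUN N R c) (hV : OneLinkVarianceBound N R vv)
    (hR : |β / N| * (2 * (n : ℝ)) ≤ R) {ε₀ ε₁ : ℝ} (h₁ : 0 ≤ ε₁) (r : ℕ) {mv : ℕ} (hmv : 1 ≤ mv)
    (hrow : Real.exp ε₀ * (2 * (n : ℝ) * |β / N| * Real.sqrt (c * vv)) + Real.sqrt (Real.exp ε₀ * c) * ε₁ < 1) :
    AreaLawOnBall N (n + 1) β ε₀ ε₁ r mv := by
  have hrow' : Real.exp ε₀ * Real.sqrt (c * vv) * (2 * (n : ℝ) * |β / N|) + Real.sqrt (Real.exp ε₀ * c) * ε₁ < 1 := by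
    have e : Real.exp ε₀ * Real.sqrt (c * vv) * (2 * (n : ℝ) * |β / N|) =
        Real.exp ε₀ * (2 * (n : ℝ) * |β / N| * Real.sqrt (c * vv)) := by ring
    rw [e]; exact hrow
  exact areaLawOnBall_of_slabCovariance (n := n) hN β ε₀ ε₁ r hmv (doorRate_pos hrow' (le_max_right (n * r) 1))
    fun L _ W hWball hWloc v t rest x y i j k l φ ψ hφ hψ =>
      slabCovariance_of_pair (by omega) (β / N) hc hvv hP hV hR h₁ r mv hrow'.le L W hWball hWloc v t rest x y
        i j k l φ ψ hφ hψ

end Ball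

end Summit.Ventures.YMGap.RobustBall

end
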